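import Mathlib.MeasureTheory.Integral.Indicator
import Summits.Ventures.PercRepro0.Coupling

/-! # L2 and F4 in Lean via the coupling: continuity in `p` of finitely-determined events (p5)

* `DeterminedBy S A`: membership in `A` depends only on the bonds of `S`.
* `tendsto_setBernoulli_of_determinedBy`: for a finite `S` and a measurable `A` determined by `S`, `p ↦ setBer(u, p) A`
  is continuous on the unit interval — proved WITHOUT polynomials: along the threshold coupling of `Coupling.lean`,
  for a.e. uniform sample `U` (no coordinate in `S` equals `p`) the thresholded configurations at `q` and at `p` agree on
  `S` for `q` near `p`, so the indicators converge; Mathlib's dominated convergence for measures does the rest.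
* the discrete intermediate-value step along an open walk (`exists_boundary_of_walk`): a walk from inside `Λ_n` to
  outside `Λ_n` (or to `∂Λ_n`) reaches `∂Λ_n` through open bonds INSIDE the box; hence `toBoundary d n` is determined by
  the finitely many bonds of `Λ_n`, is antitone in `n`, and `percolates d = ⋂ n, toBoundary d n`.
* L2: `tendsto_P_toBoundary` (`P_p(0 ↔ ∂Λ_n) → θ_d(p)`), `continuousWithinAt_theta_Ioi` (right-continuity of `θ_d`),
  **`L2_RightCont_holds (d) : L2_RightCont d`**; with `Bridge.lean` this makes `T d ↔ θ_d(p) → 0 as p ↓ p_c` unconditional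
  for `p_c(d) < 1` (`T_iff_tendsto`).
* F4: `tau_mono` (monotone in `p`), `conn_eq_iUnion_boxConn` (every connection lives in some box), `tendsto_P_boxConn`,
  **`continuousWithinAt_tau_Iio`** (left-continuity of `p ↦ τ_p(x, y)`).
-/

namespace Summit.Ventures.PercRepro0.Defs

open MeasureTheory ProbabilityTheory unitInterval Set Filter Topology
open scoped ENNReal

section Determined

variable {ι : Type*}

/-- An event is determined by the bonds of `S` if membership depends only on the coordinates in `S`. -/
def DeterminedBy (S : Set ι) (A : Set (Set ι)) : Prop :=
  ∀ ω ω' : Set ι, (∀ e ∈ S, (e ∈ ω ↔ e ∈ ω')) → (ω ∈ A ↔ ω' ∈ A)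

/-- Under the product of uniforms, almost every sample has no coordinate of a countable set equal to `p`. -/
theorem ae_ne_of_countable {S : Set ι} (hS : S.Countable) (p : ℝ) :
    ∀ᵐ U ∂(Measure.infinitePi fun _ : ι => unif), ∀ e ∈ S, U e ≠ p := by
  rw [ae_ball_iff hS]
  intro e _
  rw [ae_iff]
  simp only [not_not]
  have h : {U : ι → ℝ | U e = p} = (fun U : ι → ℝ => U e) ⁻¹' {p} := rfl
  rw [h, ← Measure.map_apply (measurable_pi_apply e) (measurableSet_singleton p),
    Measure.infinitePi_map_eval (fun _ : ι => unif) e]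
  unfold unif
  rw [Measure.restrict_apply (measurableSet_singleton p)]
  exact measure_mono_null Set.inter_subset_left (Real.volume_singleton)

/-- Continuity in `p` of `setBer(u, p) A` for a measurable event `A` determined by finitely many bonds. -/
theorem tendsto_setBernoulli_of_determinedBy (u : Set ι) {S : Set ι} (hS : S.Finite)
    {A : Set (Set ι)} (hA : MeasurableSet A) (hdet : DeterminedBy S A) (p : I) :
    Tendsto (fun q : I => setBernoulli u q A) (𝓝 p) (𝓝 (setBernoulli u p A)) := by
  have hrepr : ∀ q : I,
      setBernoulli u q A = (Measure.infinitePi fun _ : ι => unif) (threshold u q ⁻¹' A) := by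
    intro q
    rw [← map_threshold_eq_setBernoulli u q, Measure.map_apply (measurable_threshold u q) hA]
  simp_rw [hrepr]
  refine tendsto_measure_of_ae_tendsto_indicator_of_isFiniteMeasure (𝓝 p)
    ((measurable_threshold u p) hA) (fun q => (measurable_threshold u q) hA) ?_
  filter_upwards [ae_ne_of_countable hS.countable (p : ℝ)] with U hU
  have hev : ∀ᶠ q : I in 𝓝 p, ∀ e ∈ S, (U e ≤ (q : ℝ) ↔ U e ≤ (p : ℝ)) := by
    rw [Filter.eventually_all_finite hS]
    intro e he
    rcases lt_or_gt_of_ne (hU e he) with hlt | hgt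
    · filter_upwards [(continuous_subtype_val.tendsto p).eventually (lt_mem_nhds hlt)] with q hq
      exact ⟨fun _ => hlt.le, fun _ => hq.le⟩
    · filter_upwards [(continuous_subtype_val.tendsto p).eventually (gt_mem_nhds hgt)] with q hq
      exact ⟨fun h => absurd h (not_le.2 hq), fun h => absurd h (not_le.2 hgt)⟩
  filter_upwards [hev] with q hq
  show threshold u q U ∈ A ↔ threshold u p U ∈ A
  apply hdet
  intro e he
  show (e ∈ u ∧ U e ≤ (q : ℝ)) ↔ (e ∈ u ∧ U e ≤ (p : ℝ))
  rw [hq e he]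

/-- Real-valued version, composed with the clamp: `r ↦ setBer(u, clamp r) A` is continuous on `ℝ`. -/
theorem continuous_setBernoulli_clamp_of_determinedBy (u : Set ι) {S : Set ι} (hS : S.Finite)
    {A : Set (Set ι)} (hA : MeasurableSet A) (hdet : DeterminedBy S A) :
    Continuous fun r : ℝ => (setBernoulli u (clamp r) A).toReal := by
  rw [continuous_iff_continuousAt]
  intro r
  have h1 : Tendsto (fun q : I => (setBernoulli u q A).toReal) (𝓝 (clamp r))
      (𝓝 (setBernoulli u (clamp r) A).toReal) :=
    (ENNReal.tendsto_toReal (measure_ne_top _ _)).comp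
      (tendsto_setBernoulli_of_determinedBy u hS hA hdet (clamp r))
  exact h1.comp ((continuous_projIcc (a := (0 : ℝ)) (b := 1) (h := zero_le_one)).tendsto r)

end Determined

variable {d : ℕ}

/-! ### Bonds inside a box; the discrete intermediate-value step along a walk -/

/-- The bonds with both endpoints in `Λ_n`. -/
def boxBonds (d : ℕ) (n : ℕ) : Set (Sym2 (Vertex d)) := {e | ∀ v ∈ e, v ∈ box d n}

/-- `boxBonds d n` is finite. -/
theorem boxBonds_finite (n : ℕ) : (boxBonds d n).Finite := by
  refine (((box_finite n).prod (box_finite n)).image fun ab : Vertex d × Vertex d => s(ab.1, ab.2)).subset ?_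
  intro e he
  induction e using Sym2.ind with
  | h a b =>
    exact ⟨(a, b), ⟨he a (Sym2.mem_mk_left a b), he b (Sym2.mem_mk_right a b)⟩, rfl⟩

/-- Along a lattice edge every coordinate moves by at most one. -/
theorem lattice_adj_abs_sub_le {x y : Vertex d} (h : (lattice d).Adj x y) (i : Fin d) :
    |x i - y i| ≤ 1 := by
  have h1 : (∑ j, |x j - y j|) = 1 := h
  calc |x i - y i| ≤ ∑ j, |x j - y j| :=
        Finset.single_le_sum (fun j _ => abs_nonneg (x j - y j)) (Finset.mem_univ i)
    _ = 1 := h1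

/-- Discrete intermediate value step: an open walk from `a ∈ Λ_n` to a vertex outside `Λ_n` or on `∂Λ_n` reaches `∂Λ_n`
through open bonds inside `Λ_n`. -/
theorem exists_boundary_of_walk {ω : Config d} {n : ℕ} :
    ∀ {a b : Vertex d}, (openGraph d ω).Walk a b → a ∈ box d n → (b ∉ box d n ∨ b ∈ boundary d n) →
      ∃ z ∈ boundary d n, Conn d (ω ∩ boxBonds d n) a z := by
  intro a b w
  induction w with
  | nil =>
    intro ha hb
    rcases hb with hb | hb
    · exact absurd ha hb
    · exact ⟨_, hb, SimpleGraph.Reachable.refl _⟩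
  | @cons a c b hac _ ih =>
    intro ha hb
    by_cases hc : c ∈ box d n
    · obtain ⟨z, hz, hconn⟩ := ih hc hb
      refine ⟨z, hz, (SimpleGraph.Adj.reachable ?_).trans hconn⟩
      rw [openGraph, SimpleGraph.fromEdgeSet_adj] at hac ⊢
      refine ⟨⟨⟨hac.1.1, fun v hv => ?_⟩, hac.1.2⟩, hac.2⟩
      rcases Sym2.mem_iff.1 hv with rfl | rfl
      · exact ha
      · exact hc
    · refine ⟨a, ⟨ha, ?_⟩, SimpleGraph.Reachable.refl _⟩
      have hadj : (lattice d).Adj a c := openGraph_le ω hac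
      have hc' : ∃ i, (n : ℤ) < |c i| := by
        by_contra hcon
        apply hc
        intro i
        by_contra hi
        exact hcon ⟨i, not_le.1 hi⟩
      obtain ⟨i, hi⟩ := hc'
      refine ⟨i, ?_⟩
      have h1 := lattice_adj_abs_sub_le hadj i
      have h2 : |a i| ≤ n := ha i
      have h3 : |c i| ≤ |a i| + |a i - c i| := by
        calc |c i| = |a i - (a i - c i)| := by rw [sub_sub_cancel]
          _ ≤ |a i| + |a i - c i| := abs_sub _ _
      exact le_antisymm h2 (by linarith)

/-- `0 ∈ Λ_n`. -/
theorem zero_mem_box (n : ℕ) : (0 : Vertex d) ∈ box d n := fun i => by simp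

/-- Points of `∂Λ_{n+1}` are outside `Λ_n`. -/
theorem notMem_box_of_mem_boundary_succ {n : ℕ} {z : Vertex d} (hz : z ∈ boundary d (n + 1)) :
    z ∉ box d n := by
  obtain ⟨_, i, hi⟩ := hz
  intro hb
  have := hb i
  rw [hi] at this
  push_cast at this
  linarith

/-- `{0 ↔ ∂Λ_n}` is witnessed inside the box. -/
theorem toBoundary_eq_boxConn (n : ℕ) :
    toBoundary d n = {ω : Config d | ∃ z ∈ boundary d n, Conn d (ω ∩ boxBonds d n) 0 z} := by
  ext ω
  constructor
  · rintro ⟨y, hy, ⟨w⟩⟩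
    exact exists_boundary_of_walk w (zero_mem_box n) (Or.inr hy)
  · rintro ⟨z, hz, hc⟩
    exact ⟨z, hz, conn_mono Set.inter_subset_left hc⟩

/-- `{0 ↔ ∂Λ_n}` is determined by the bonds of `Λ_n`. -/
theorem determinedBy_toBoundary (n : ℕ) : DeterminedBy (boxBonds d n) (toBoundary d n) := by
  intro ω ω' h
  have hinter : ω ∩ boxBonds d n = ω' ∩ boxBonds d n := by
    ext e
    exact ⟨fun ⟨h1, h2⟩ => ⟨(h e h2).1 h1, h2⟩, fun ⟨h1, h2⟩ => ⟨(h e h2).2 h1, h2⟩⟩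
  rw [toBoundary_eq_boxConn]
  show (∃ z ∈ boundary d n, Conn d (ω ∩ boxBonds d n) 0 z) ↔
    ∃ z ∈ boundary d n, Conn d (ω' ∩ boxBonds d n) 0 z
  rw [hinter]

/-- `{0 ↔ ∂Λ_n}` is antitone in `n`. -/
theorem toBoundary_antitone : Antitone fun n : ℕ => toBoundary d n := by
  refine antitone_nat_of_succ_le fun n ω hω => ?_
  obtain ⟨y, hy, ⟨w⟩⟩ := hω
  obtain ⟨z, hz, hc⟩ :=
    exists_boundary_of_walk w (zero_mem_box n) (Or.inl (notMem_box_of_mem_boundary_succ hy))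
  exact ⟨z, hz, conn_mono Set.inter_subset_left hc⟩

/-- `{0 ↔ ∞} = ⋂ₙ {0 ↔ ∂Λ_n}` (F1(b) of FOUNDATIONS-p5). -/
theorem percolates_eq_iInter_toBoundary : percolates d = ⋂ n : ℕ, toBoundary d n := by
  ext ω
  rw [Set.mem_iInter]
  constructor
  · intro hω n
    obtain ⟨y, hy, ⟨w⟩⟩ := (connInf_iff ω 0).1 hω n
    obtain ⟨z, hz, hc⟩ := exists_boundary_of_walk w (zero_mem_box n) (Or.inl hy)
    exact ⟨z, hz, conn_mono Set.inter_subset_left hc⟩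
  · intro h
    refine (connInf_iff ω 0).2 fun n => ?_
    obtain ⟨z, hz, hc⟩ := h (n + 1)
    exact ⟨z, notMem_box_of_mem_boundary_succ hz, hc⟩

/-! ### L2: the finite-box limit and right-continuity of `θ_d` -/

/-- L2(i): `P_p(0 ↔ ∂Λ_n) → θ_d(p)` as `n → ∞`. -/
theorem tendsto_P_toBoundary (p : I) :
    Tendsto (fun n : ℕ => (P d p (toBoundary d n)).toReal) atTop (𝓝 (thetaI d p)) := by
  have h : Tendsto (fun n : ℕ => P d p (toBoundary d n)) atTop (𝓝 (P d p (percolates d))) := by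
    rw [percolates_eq_iInter_toBoundary]
    exact tendsto_measure_iInter_atTop (fun n => (measurableSet_toBoundary n).nullMeasurableSet)
      toBoundary_antitone ⟨0, measure_ne_top _ _⟩
  exact (ENNReal.tendsto_toReal (measure_ne_top _ _)).comp h

/-- `θ_d(p) ≤ P_p(0 ↔ ∂Λ_n)`. -/
theorem thetaI_le_P_toBoundary (p : I) (n : ℕ) :
    thetaI d p ≤ (P d p (toBoundary d n)).toReal := by
  unfold thetaI
  refine ENNReal.toReal_mono (measure_ne_top _ _) (measure_mono ?_)
  rw [percolates_eq_iInter_toBoundary]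
  exact Set.iInter_subset _ n

/-- The clamped box probabilities are continuous in `p`. -/
theorem continuous_theta_box (n : ℕ) :
    Continuous fun r : ℝ => (P d (clamp r) (toBoundary d n)).toReal :=
  continuous_setBernoulli_clamp_of_determinedBy (bonds d) (boxBonds_finite n)
    (measurableSet_toBoundary n) (determinedBy_toBoundary n)

/-- L2(ii): `θ_d` is right-continuous at every `p ∈ [0, 1)`. -/
theorem continuousWithinAt_theta_Ioi (p : ℝ) :
    ContinuousWithinAt (theta d) (Set.Ioi p) p := by
  rw [Metric.continuousWithinAt_iff]
  intro ε hε
  obtain ⟨N, hN⟩ := (Metric.tendsto_atTop.1 (tendsto_P_toBoundary (d := d) (clamp p))) (ε / 2)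
    (by linarith)
  have hN' : (P d (clamp p) (toBoundary d N)).toReal < theta d p + ε / 2 := by
    have := hN N le_rfl
    rw [Real.dist_eq, abs_lt] at this
    unfold theta
    linarith [this.2]
  obtain ⟨δ, hδ, hδN⟩ := Metric.continuousAt_iff.1 ((continuous_theta_box (d := d) N).continuousAt
    (x := p)) (ε / 2) (by linarith)
  refine ⟨δ, hδ, fun q hqI hq => ?_⟩
  have h1 : theta d p ≤ theta d q := theta_mono (le_of_lt (Set.mem_Ioi.1 hqI))
  have h2 : theta d q ≤ (P d (clamp q) (toBoundary d N)).toReal := thetaI_le_P_toBoundary _ N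
  have h3 := hδN hq
  rw [Real.dist_eq, abs_lt] at h3
  rw [Real.dist_eq, abs_lt]
  constructor <;> linarith [h3.2]

/-- L2 · RIGHT-CONT holds. -/
theorem L2_RightCont_holds (d : ℕ) : L2_RightCont d :=
  ⟨fun p => tendsto_P_toBoundary p, fun p _ _ => continuousWithinAt_theta_Ioi p⟩

/-- Unconditional bridge (`p_c(d) < 1`): `T d ↔ θ_d(p) → 0 as p ↓ p_c(d)`. -/
theorem T_iff_tendsto (hpc : pc d < 1) :
    T d ↔ Tendsto (theta d) (𝓝[>] (pc d)) (𝓝 0) :=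
  T_iff_tendsto_of_rightCont (rightCont_at_pc_of_L2 (L2_RightCont_holds d) hpc)

/-! ### F4: monotonicity and left-continuity of the two-point function -/

/-- `τ_p(x, y)` is non-decreasing in `p`. -/
theorem tau_mono (x y : Vertex d) : Monotone fun p : I => tau d p x y := by
  intro p q hpq
  unfold tau
  exact ENNReal.toReal_mono (measure_ne_top _ _)
    (L1_Monotone_holds d p q hpq _ (isUpperSet_conn x y) (measurableSet_conn x y))

/-- The connection event inside the box `Λ_n`. -/
def boxConn (d : ℕ) (n : ℕ) (x y : Vertex d) : Set (Config d) :=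
  {ω | Conn d (ω ∩ boxBonds d n) x y}

/-- `boxConn` is measurable. -/
theorem measurableSet_boxConn (n : ℕ) (x y : Vertex d) : MeasurableSet (boxConn d n x y) := by
  have : boxConn d n x y = (fun ω : Config d => ω ∩ boxBonds d n) ⁻¹' {ω : Config d | Conn d ω x y} :=
    rfl
  rw [this]
  refine (measurableSet_conn x y).preimage ?_
  rw [measurable_set_iff]
  intro a
  by_cases ha : a ∈ boxBonds d n
  · have h : (fun ω : Config d => a ∈ ω ∩ boxBonds d n) = fun ω => a ∈ ω := by
      funext ω
      simp [ha]
    rw [h]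
    exact measurable_set_mem a
  · have h : (fun ω : Config d => a ∈ ω ∩ boxBonds d n) = fun _ => False := by
      funext ω
      simp [ha]
    rw [h]
    exact measurable_const

/-- `boxConn` is determined by the bonds of `Λ_n`. -/
theorem determinedBy_boxConn (n : ℕ) (x y : Vertex d) :
    DeterminedBy (boxBonds d n) (boxConn d n x y) := by
  intro ω ω' h
  have hinter : ω ∩ boxBonds d n = ω' ∩ boxBonds d n := by
    ext e
    exact ⟨fun ⟨h1, h2⟩ => ⟨(h e h2).1 h1, h2⟩, fun ⟨h1, h2⟩ => ⟨(h e h2).2 h1, h2⟩⟩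
  show Conn d (ω ∩ boxBonds d n) x y ↔ Conn d (ω' ∩ boxBonds d n) x y
  rw [hinter]

/-- `boxConn` is monotone in `n`. -/
theorem boxConn_monotone (x y : Vertex d) : Monotone fun n : ℕ => boxConn d n x y := by
  refine monotone_nat_of_le_succ fun n ω hω => ?_
  refine conn_mono (Set.inter_subset_inter_right _ ?_) hω
  intro e he v hv i
  exact (he v hv i).trans (by push_cast; linarith)

/-- Endpoints of the edges of a walk lie on its support. -/
theorem mem_support_of_mem_edges_of_mem {V : Type*} {G : SimpleGraph V} {a b : V} (w : G.Walk a b)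
    {e : Sym2 V} (he : e ∈ w.edges) {v : V} (hv : v ∈ e) : v ∈ w.support := by
  induction e using Sym2.ind with
  | h s t =>
    rcases Sym2.mem_iff.1 hv with rfl | rfl
    · exact w.fst_mem_support_of_mem_edges he
    · exact w.snd_mem_support_of_mem_edges he

/-- Every connection lives in some box: `{x ↔ y} = ⋃ₙ boxConn n x y`. -/
theorem conn_eq_iUnion_boxConn (x y : Vertex d) :
    {ω : Config d | Conn d ω x y} = ⋃ n : ℕ, boxConn d n x y := by
  ext ω
  rw [Set.mem_iUnion]
  constructor
  · rintro ⟨w⟩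
    obtain ⟨M, hM⟩ := ((w.support.toFinset.finite_toSet).image fun v : Vertex d => ∑ i, |v i|).bddAbove
    refine ⟨M.toNat, ?_⟩
    show Conn d (ω ∩ boxBonds d M.toNat) x y
    have hsupp : ∀ v ∈ w.support, v ∈ box d M.toNat := by
      intro v hv i
      have h1 : ∑ j, |v j| ≤ M := hM ⟨v, by simpa using hv, rfl⟩
      have h2 : |v i| ≤ ∑ j, |v j| :=
        Finset.single_le_sum (fun j _ => abs_nonneg (v j)) (Finset.mem_univ i)
      exact h2.trans (h1.trans (Int.self_le_toNat M))
    refine ⟨w.transfer (openGraph d (ω ∩ boxBonds d M.toNat)) fun e he => ?_⟩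
    have h := w.edges_subset_edgeSet he
    rw [openGraph, SimpleGraph.edgeSet_fromEdgeSet] at h ⊢
    exact ⟨⟨⟨h.1.1, fun v hv => hsupp v (mem_support_of_mem_edges_of_mem w he hv)⟩, h.1.2⟩, h.2⟩
  · rintro ⟨n, hn⟩
    exact conn_mono Set.inter_subset_left hn

/-- `P_p(boxConn n x y) → τ_p(x, y)` as `n → ∞` (continuity from below). -/
theorem tendsto_P_boxConn (p : I) (x y : Vertex d) :
    Tendsto (fun n : ℕ => (P d p (boxConn d n x y)).toReal) atTop (𝓝 (tau d p x y)) := by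
  have h : Tendsto (fun n : ℕ => P d p (boxConn d n x y)) atTop
      (𝓝 (P d p {ω : Config d | Conn d ω x y})) := by
    rw [conn_eq_iUnion_boxConn]
    exact tendsto_measure_iUnion_atTop (boxConn_monotone x y)
  exact (ENNReal.tendsto_toReal (measure_ne_top _ _)).comp h

/-- `P_p(boxConn n x y) ≤ τ_p(x, y)`. -/
theorem P_boxConn_le_tau (p : I) (n : ℕ) (x y : Vertex d) :
    (P d p (boxConn d n x y)).toReal ≤ tau d p x y := by
  unfold tau
  refine ENNReal.toReal_mono (measure_ne_top _ _) (measure_mono ?_)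
  rw [conn_eq_iUnion_boxConn]
  exact Set.subset_iUnion (fun n => boxConn d n x y) n

/-- The clamped box-connection probabilities are continuous in `p`. -/
theorem continuous_tau_box (n : ℕ) (x y : Vertex d) :
    Continuous fun r : ℝ => (P d (clamp r) (boxConn d n x y)).toReal :=
  continuous_setBernoulli_clamp_of_determinedBy (bonds d) (boxBonds_finite n)
    (measurableSet_boxConn n x y) (determinedBy_boxConn n x y)

/-- F4(ii): `p ↦ τ_p(x, y)` (clamped to `ℝ`) is left-continuous at every `p`. -/
theorem continuousWithinAt_tau_Iio (x y : Vertex d) (p : ℝ) :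
    ContinuousWithinAt (fun r : ℝ => tau d (clamp r) x y) (Set.Iio p) p := by
  rw [Metric.continuousWithinAt_iff]
  intro ε hε
  obtain ⟨N, hN⟩ := (Metric.tendsto_atTop.1 (tendsto_P_boxConn (d := d) (clamp p) x y)) (ε / 2)
    (by linarith)
  have hN' : tau d (clamp p) x y - ε / 2 < (P d (clamp p) (boxConn d N x y)).toReal := by
    have := hN N le_rfl
    rw [Real.dist_eq, abs_lt] at this
    linarith [this.1]
  obtain ⟨δ, hδ, hδN⟩ := Metric.continuousAt_iff.1
    ((continuous_tau_box (d := d) N x y).continuousAt (x := p)) (ε / 2) (by linarith)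
  refine ⟨δ, hδ, fun q hqI hq => ?_⟩
  have h1 : tau d (clamp q) x y ≤ tau d (clamp p) x y :=
    tau_mono x y (Set.monotone_projIcc zero_le_one (le_of_lt (Set.mem_Iio.1 hqI)))
  have h2 : (P d (clamp q) (boxConn d N x y)).toReal ≤ tau d (clamp q) x y :=
    P_boxConn_le_tau _ N x y
  have h3 := hδN hq
  rw [Real.dist_eq, abs_lt] at h3
  rw [Real.dist_eq, abs_lt]
  constructor <;> linarith [h3.1, h3.2]

end Summit.Ventures.PercRepro0.Defs
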